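import Summits.BirchSwinnertonDyer.BirchSwinnertonDyer.Theorems.KolyvaginRoadThreeMethod2OrdinaryLocalDefs
import Literature.NumberTheory.EllipticCurves.ZhangLevelRaisedHeegnerData
import HarnessLib

/-!
# KOLY method line, crux stmt-BirchSwinnertonDyer-19574 `ZhangSharpFrameAtThreeHL`, stub S2-ENGINE: the GENUINE local
# transverse condition in the Poitou–Tate model (cell `bsd-stepL`, ACCEL seat `bsd-stepL-koly3b` g6;
# `--supports stmt-BirchSwinnertonDyer-19574`, helper; definition lane)

WHY. The (J) half of S2-ENGINE's (Supply) binder (`ZhangSupply.hjump_of_localLagrangians`, part XVIII, p517552) asks, at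
the place `λ′ = plK ℓ′` of every Kolyvagin prime, for a LOCAL condition `Ltr λ′ ≤ H¹(K_λ′, E[3])` in the Poitou–Tate model
that is isotropic for the local Weil cup product, has `#Ltr · #Ltr = #H¹(K_λ′, E[3])` (`= 81`), and whose preimage under the
localisation lies in the tree's GLOBAL-currency transverse condition `Method2.transverseLocalKer` (W. Zhang §8.1
`H¹_tr`: cocycle vanishing on `G_𝔓 ∩ Gal(K̄/K[ℓ])`). This file types it, next to `Method2.ordinaryLocalCondition`
(p519040): `Method2.transverseLocalCondition E ι ℓ L n ≤ H¹(Γ_L, E[n](K̄)|_{Γ_L})` for a Weierstrass curve `E/K`, the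
complex embedding `ι` of the frame, the conductor `ℓ`, a `K`-field `L` (a completion) and `n : ℤ` — the classes
represented by a continuous cocycle VANISHING on `res⁻¹(Stab K[ℓ])` (`ringClassStabilizer K ι ℓ ℓ`), i.e. inflated from
`Gal(L·K[ℓ]/L)`. At a Kolyvagin `λ` (`Γ_{K_λ}` fixes `E[3]`, `λ` splits in `K[1]` and is totally ramified in
`K[ℓ]/K[1]`) these are the `9` classes `s ↦ k(s) • Q` along the cyclic `Gal(K[ℓ]/K[1])` — proved in the companion proof
files `KolyvaginRoadThreeZhangSupplyTransverse*.lean` (dictionary, isotropy, count).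

HONEST FRAMING: one definition with body + its unfolding lemma; 0 named facts, 0 `sorry`, no instance, no notation;
nothing is asserted; closes nothing (T7). PARTITION: O2@3 (B10) × A1 × crux 19574 × stub S2-ENGINE — types-the-object-of.

References: [cite: WZhang2014, §8.1 (H¹_tr)] [cite: GrossLMS1991, §3–§4 (K_λ[ℓ]/K_λ, singular classes)]
[cite: SerreGaloisCohomology1997, I.§5.1 (classes by cocycle representatives)].
-/

noncomputable section

open scoped Classical

universe u

namespace Summit.BirchSwinnertonDyer.Rank1Residual.X11b.Three.Koly.Method2

open CategoryTheory WeierstrassCurve Field Function NumberField IsDedekindDomain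
open Literature.NumberTheory.EllipticCurves Literature.NumberTheory.GaloisRepresentations

section Defs

variable {K : Type u} [Field K] [NumberField K] (E : WeierstrassCurve K) (ι : K →+* ℂ) (ℓ : ℕ)
  (L : Type u) [Field L] [Algebra K L]

/-- **The GENUINE local transverse condition** at a `K`-field `L` (a completion `K_λ`) for the ring class field
`K[ℓ]`, in the Poitou–Tate model `H¹(Γ_L, E[n](K̄)|_{Γ_L})`: the local classes represented by a continuous cocycle
VANISHING at every `s ∈ Γ_L` whose restriction to `K̄` fixes `K[ℓ]` (`ringClassStabilizer K ι ℓ ℓ`), i.e. inflated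
from `Gal(L·K[ℓ]/L)` — W. Zhang's `H¹_tr(K_λ, E[p])` (§8.1), Gross's singular classes split by `K_λ[ℓ]` (§3–§4).
Companion of the GLOBAL-currency `Method2.transverseLocalKer` (= its preimage under the localisation at a Kolyvagin
prime: `ZhangSupply.htrIncl_transverseLocalCondition`). A definition; nothing asserted.
[cite: WZhang2014, §8.1 (H¹_tr)] [cite: GrossLMS1991, §3–§4] -/
def transverseLocalCondition (n : ℤ) :
    AddSubgroup (galoisCohomology (GaloisRep.restrictField L (E.torsionGaloisModule n)) 1) where
  carrier := {a | ∃ ψ : contOneCocycles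
      (DiscreteGaloisModule.toTopRep (GaloisRep.restrictField L (E.torsionGaloisModule n))),
    (∀ s : absoluteGaloisGroup L, absGaloisRestrict K L s ∈ ringClassStabilizer K ι ℓ ℓ → ψ.1 s = 0) ∧
      oneCocycleClass _ ψ = a}
  zero_mem' := ⟨0, fun _ _ ↦ rfl, oneCocycleClass_zero _⟩
  add_mem' := by
    rintro a b ⟨φ, hφ, rfl⟩ ⟨ψ, hψ, rfl⟩
    refine ⟨φ + ψ, fun s hs ↦ ?_, oneCocycleClass_add _ φ ψ⟩
    change φ.1 s + ψ.1 s = 0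
    rw [hφ s hs, hψ s hs, add_zero]
  neg_mem' := by
    rintro a ⟨φ, hφ, rfl⟩
    refine ⟨-φ, fun s hs ↦ ?_, ?_⟩
    · change -(φ.1 s) = 0
      rw [hφ s hs, neg_zero]
    · have h := oneCocycleClass_sub _ (0 : contOneCocycles _) φ
      rw [zero_sub, oneCocycleClass_zero, zero_sub] at h
      exact h

variable {E ι ℓ L} in
/-- Membership in the genuine local transverse condition (definitional). [cite: WZhang2014, §8.1 (H¹_tr)] -/
theorem mem_transverseLocalCondition_iff {n : ℤ}
    {a : galoisCohomology (GaloisRep.restrictField L (E.torsionGaloisModule n)) 1} :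
    a ∈ transverseLocalCondition E ι ℓ L n ↔ ∃ ψ : contOneCocycles
      (DiscreteGaloisModule.toTopRep (GaloisRep.restrictField L (E.torsionGaloisModule n))),
      (∀ s : absoluteGaloisGroup L, absGaloisRestrict K L s ∈ ringClassStabilizer K ι ℓ ℓ → ψ.1 s = 0) ∧
        oneCocycleClass _ ψ = a :=
  Iff.rfl

end Defs

end Summit.BirchSwinnertonDyer.Rank1Residual.X11b.Three.Koly.Method2

end
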